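import Literature.NumberTheory.LFunctions.ConreyIwaniec2002Prop91Unrestricted
import HarnessLib

/-!
# Conrey–Iwaniec (2002), Proposition 8.1 for ARBITRARY companions in the range of the mean squares

B. Conrey, H. Iwaniec, *Spacing of zeros of Hecke L-functions and the class number problem*,
Acta Arith. 103 (2002), §§7–8 [held text `paper:arxiv-math_0111012`, p0017–p0019]: Proposition 8.1
(8.10) bounds `D(T) = Σ_s |ℓ(s) − x(s)N̄(s)|²` over `1`-spaced `s = ½ + it`, `T < t ≤ 2T`, with
companions `s′ = ½ + it′` UNRESTRICTED (8.4). The tree holds (8.10) from Proposition 6.4 (binder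
`h64`) only for CLOSE companions `|t′ − t| ≤ 1` (`conreyIwaniec2002_proposition81_large_close`,
`…_of_proposition64`), and the cell's record said the unrestricted form needs subconvexity
(ls-inputs HANDOFF, I6b-lead g4 "R-a"). It does not: for `|t′ − t| > 1` the summand is
`|ℓ(s) − x(s)N̄(s)|² ≤ 3|L(s)|² + 3|L(s′)|²/|t − t′|² + 12|N(s)|²` (`far_pointwise_D`;
`|ℓ(s)| ≤ (|L(s)| + |L(s′)|)/|t − t′|`, `|x(s)| ≤ 2/|t − t′|`) — every term is the square of ONE
`L`-value, so no product `|L(s′)|²|N(s)|²` and no pointwise bound at `t′ ≍ T` ever arises: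
* `Σ_s |L(s)|²` and `Σ_s |N(s)|²` are the tree's discrete mean squares
  (`sum_norm_classGroupLFunction_sq_le`, `sum_norm_shortLSum_sq_le`);
* `Σ_{1<|t−t′|≤T/4} |L(s′)|²/|t − t′|²` is the far-companion sum already controlled for Proposition
  9.1 by the maximiser trick of `ConreyIwaniec2002Prop91FarCompanions` (`far_sum_le_sup_sum`,
  `sum_sup_le`: `≤ 13π·2·66·C_L·X` from the mean squares in the windows at `T/2`, `T`, `2T`) —
  isolated here as `far_companion_sq_sum_le`;
* `|L(s′)|²/|t − t′|² ≤ C` for `|t − t′| > T/4` by convexity alone (`norm_sq_le_sq_dist_of_remote`).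
RESULT (PROVED, modulo the typed Proposition 6.4 = binder `h64` only):
`prop81_unrestricted_of_proposition64` — (8.10) VERBATIM, `D(T) ≤ C(T(log q)^7 + Tℒ(T)(log T)^4)`,
for `1`-spaced `S ⊂ (T, 2T]` and an ARBITRARY companion map `t′ : ℝ → ℝ`, in the range
`2q^66 ≤ T`, `2e^{(log q)²} ≤ T` (the factor `2` = the window `(T/2, T]` of the maximisers of
companions below `T`; the binder of record `h81` of `prop91_large_of_prop81_large_corollary63_large`
has `q^65 ≤ T`, `e^{(log q)²} ≤ T`, a range constant not reachable from the typed Proposition 6.4 by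
the printed argument — see `ConreyIwaniec2002Prop91Unrestricted`). No definition, no named fact.

«The programme SEARCHES and TYPES; no claim about Landau–Siegel zeros, Theorems 1–2 of
arXiv:2211.02515 or a repaired Margin232 until a kernel theorem says so.»

## References
* [ConreyIwaniec2002] B. Conrey, H. Iwaniec, Acta Arith. 103 (2002) 259–312, arXiv:math/0111012:
  (7.19)–(7.20), (7.26), §8 (8.1)–(8.4), Proposition 8.1 (8.10), Lemma 5.3, §9 (9.1).
-/

noncomputable section

open scoped NumberField ComplexConjugate
open Complex

namespace Literature.NumberTheory.LFunctions

namespace ConreyIwaniec2002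

open NumberField

/-! ### §1. A far companion, pointwise, in `D(T)` -/

/-- `(a + b + c)² ≤ 3(a² + b² + c²)`; private plumbing. [folklore] -/
private theorem sq_add_three_le (a b c : ℝ) : (a + b + c) ^ 2 ≤ 3 * (a ^ 2 + b ^ 2 + c ^ 2) := by
  nlinarith [sq_nonneg (a - b), sq_nonneg (b - c), sq_nonneg (a - c)]

variable (K : Type) [Field K] [NumberField K]

/-- **A FAR companion, pointwise, in `D(T)`**: for `|t′ − t| > 1`,
`|ℓ(s) − x(s)N̄(s)|² ≤ 3|L(s)|² + 3|L(s′)|²/|t − t′|² + 12|N(s)|²` — from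
`|ℓ(s)| ≤ (|L(s)| + |L(s′)|)/|t − t′|` (7.19) and `|x(s)| ≤ 2/|t − t′|` ((7.20), `|X| = 1` on the
line (7.26)): the summand of (8.10) is a sum of squares of SINGLE `L`-values.
[cite: ConreyIwaniec2002, Proposition 8.1; (7.19)–(7.20), (7.26)] -/
theorem far_pointwise_D (ψ : ClassGroup (𝓞 K) →* ℂˣ) {q : ℕ} (hq : 0 < q) {t t' : ℝ}
    (h : 1 < |t' - t|) :
    ‖dividedDifference (classGroupLFunction K ψ) (1 / 2 + t * I) (1 / 2 + t' * I) -
        xQuot q (1 / 2 + t * I) (1 / 2 + t' * I) *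
          starRingEnd ℂ (shortLSum K ψ q (1 / 2 + t * I))‖ ^ 2 ≤
      3 * ‖classGroupLFunction K ψ (1 / 2 + t * I)‖ ^ 2 +
        3 * (‖classGroupLFunction K ψ (1 / 2 + t' * I)‖ ^ 2 / (t' - t) ^ 2) +
        12 * ‖shortLSum K ψ q (1 / 2 + t * I)‖ ^ 2 := by
  have hne : t' ≠ t := by
    intro e; rw [e, sub_self, abs_zero] at h; linarith
  have hd0 : 0 < |t' - t| := by linarith
  have hℓ := norm_dividedDifference_half_le (classGroupLFunction K ψ) hne
  have hx := norm_xQuot_le_two_div hq hne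
  set d : ℝ := |t' - t| with hd
  set Lt := classGroupLFunction K ψ (1 / 2 + t * I)
  set Lt' := classGroupLFunction K ψ (1 / 2 + t' * I)
  set N := shortLSum K ψ q (1 / 2 + t * I)
  have hN0 : 0 ≤ ‖N‖ := norm_nonneg _
  have hL0 : 0 ≤ ‖Lt‖ := norm_nonneg _
  have hL0' : 0 ≤ ‖Lt'‖ := norm_nonneg _
  have hinv : 1 / d ≤ 1 := by rw [div_le_one hd0]; exact h.le
  -- the linear bound `|ℓ − xN̄| ≤ |L(s)| + |L(s′)|/d + 2|N(s)|`
  have hlin : ‖dividedDifference (classGroupLFunction K ψ) (1 / 2 + t * I) (1 / 2 + t' * I) -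
        xQuot q (1 / 2 + t * I) (1 / 2 + t' * I) * starRingEnd ℂ N‖ ≤
      ‖Lt‖ + ‖Lt'‖ / d + 2 * ‖N‖ := by
    calc ‖dividedDifference (classGroupLFunction K ψ) (1 / 2 + t * I) (1 / 2 + t' * I) -
            xQuot q (1 / 2 + t * I) (1 / 2 + t' * I) * starRingEnd ℂ N‖
        ≤ ‖dividedDifference (classGroupLFunction K ψ) (1 / 2 + t * I) (1 / 2 + t' * I)‖ +
            ‖xQuot q (1 / 2 + t * I) (1 / 2 + t' * I) * starRingEnd ℂ N‖ := norm_sub_le _ _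
      _ = ‖dividedDifference (classGroupLFunction K ψ) (1 / 2 + t * I) (1 / 2 + t' * I)‖ +
            ‖xQuot q (1 / 2 + t * I) (1 / 2 + t' * I)‖ * ‖N‖ := by
          rw [norm_mul, RCLike.norm_conj]
      _ ≤ (‖Lt‖ + ‖Lt'‖) / d + 2 / d * ‖N‖ := by gcongr
      _ = (1 / d) * ‖Lt‖ + ‖Lt'‖ / d + (1 / d) * (2 * ‖N‖) := by ring
      _ ≤ 1 * ‖Lt‖ + ‖Lt'‖ / d + 1 * (2 * ‖N‖) := by gcongr
      _ = ‖Lt‖ + ‖Lt'‖ / d + 2 * ‖N‖ := by ring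
  have h0 : 0 ≤ ‖dividedDifference (classGroupLFunction K ψ) (1 / 2 + t * I) (1 / 2 + t' * I) -
        xQuot q (1 / 2 + t * I) (1 / 2 + t' * I) * starRingEnd ℂ N‖ := norm_nonneg _
  calc ‖dividedDifference (classGroupLFunction K ψ) (1 / 2 + t * I) (1 / 2 + t' * I) -
          xQuot q (1 / 2 + t * I) (1 / 2 + t' * I) * starRingEnd ℂ N‖ ^ 2
      ≤ (‖Lt‖ + ‖Lt'‖ / d + 2 * ‖N‖) ^ 2 := pow_le_pow_left₀ h0 hlin 2
    _ ≤ 3 * (‖Lt‖ ^ 2 + (‖Lt'‖ / d) ^ 2 + (2 * ‖N‖) ^ 2) := sq_add_three_le _ _ _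
    _ = 3 * ‖Lt‖ ^ 2 + 3 * (‖Lt'‖ ^ 2 / (t' - t) ^ 2) + 12 * ‖N‖ ^ 2 := by
        rw [div_pow, hd, sq_abs]; ring

variable {K}

/-! ### §2. The far-companion sum `Σ |L(s′)|²/|t − t′|²` -/

/-- **THE FAR-COMPANION SUM.** For `q` odd `> 4`, `K = ℚ(√−q)`, `ψ ∈ Ĉℓ(K)`, a `1`-spaced
`S ⊂ (T, 2T]` with `2q^66 ≤ T`, `2e^{(log q)²} ≤ T`, and companions `1 < |t′ − t| ≤ T/4`:
`Σ_{t∈S} |L(½+it′,ψ)|²/|t′ − t|² ≤ C·(T(log q)^7 + Tℒ(T)(log T)^4)` — by the maximiser trick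
(`far_sum_le_sup_sum`: grouping the companions by `k = ⌊t′⌋`, `Σ_{⌊t′⌋=k}|t−t′|^{−2} ≤ 13π`) and
the discrete mean square of `L` over the two parity classes of maximisers `u_k ∈ [k, k+1]`, which are
`1`-spaced point sets of the windows at `T/2`, `T`, `2T` (`sum_sup_le`,
`sum_norm_classGroupLFunction_sq_le` from Proposition 6.4). This is the block of
`prop91_far_of_proposition64`, isolated because Proposition 8.1 needs the same sum.
[cite: ConreyIwaniec2002, Proposition 8.1 (8.10); Lemma 5.3; §9 (9.1)] -/
theorem far_companion_sq_sum_le (h64 : conreyIwaniec2002_proposition64) :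
    ∃ C : ℝ, 0 < C ∧
    ∀ (q : ℕ) [NeZero q], 4 < q → Odd q → ∀ χ : DirichletCharacter ℂ q,
      χ.IsPrimitive → χ.IsQuadratic → χ.Odd →
        ∀ (K : Type) [Field K] [NumberField K],
          Module.finrank ℚ K = 2 → NumberField.discr K = -(q : ℤ) →
            ∀ (ψ : ClassGroup (𝓞 K) →* ℂˣ) (T : ℝ) (S : Finset ℝ) (t' : ℝ → ℝ),
              2 * (q : ℝ) ^ (66 : ℕ) ≤ T → 2 * Real.exp (Real.log q ^ (2 : ℕ)) ≤ T →
                IsDyadicPointSet S T → (∀ t ∈ S, 1 < |t' t - t| ∧ |t' t - t| ≤ T / 4) →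
                ∑ t ∈ S, ‖classGroupLFunction K ψ (1 / 2 + t' t * I)‖ ^ 2 / (t' t - t) ^ 2 ≤
                  C * (T * Real.log q ^ (7 : ℕ) + T * calL χ T * Real.log T ^ (4 : ℕ)) := by
  obtain ⟨CL, hCL, hL⟩ := sum_norm_classGroupLFunction_sq_le h64
  refine ⟨13 * Real.pi * (132 * CL), by positivity,
    fun q _ hq hodd χ hprim hquad hoddχ K _ _ h2 hdisc ψ T S t' hT hexpT hS hcomp => ?_⟩
  classical
  -- numerics
  have hq0 : 0 < q := by omega
  have hq5 : (5 : ℝ) ≤ q := by exact_mod_cast hq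
  have hpow0 : 0 ≤ (q : ℝ) ^ (66 : ℕ) := by positivity
  have hexp0 := Real.exp_pos (Real.log q ^ (2 : ℕ))
  have hT66 : (q : ℝ) ^ (66 : ℕ) ≤ T := by linarith
  have hexp1 : Real.exp (Real.log q ^ (2 : ℕ)) ≤ T := by linarith
  have hT66h : (q : ℝ) ^ (66 : ℕ) ≤ T / 2 := by linarith
  have hexph : Real.exp (Real.log q ^ (2 : ℕ)) ≤ T / 2 := by linarith
  have hT66d : (q : ℝ) ^ (66 : ℕ) ≤ 2 * T := by linarith
  have hexpd : Real.exp (Real.log q ^ (2 : ℕ)) ≤ 2 * T := by linarith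
  obtain ⟨hℓ1, hℓLT, hLT1, -, hq41, -, hT3, -⟩ := prop81_numerics hq hT66 hexp1
  have hT0 : 0 < T := by linarith
  have h625 : (5 : ℝ) ^ (4 : ℕ) ≤ (q : ℝ) ^ (4 : ℕ) := pow_le_pow_left₀ (by norm_num) hq5 4
  have hq4cast : ((q ^ 4 : ℕ) : ℝ) = (q : ℝ) ^ (4 : ℕ) := by push_cast; ring
  have hT4 : (626 : ℝ) ≤ T := by norm_num at h625; linarith
  have hT2 : (2 : ℝ) ≤ T := by linarith
  set ℓ : ℝ := Real.log q with hℓ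
  set LT : ℝ := Real.log T with hLT
  set cLT : ℝ := calL χ T with hcLT
  have hℓ0 : 0 ≤ ℓ := by linarith
  have hcLT0 : 0 ≤ cLT := calL_nonneg χ (by linarith)
  set X : ℝ := T * ℓ ^ (7 : ℕ) + T * cLT * LT ^ (4 : ℕ) with hX
  have hX0 : 0 ≤ X := by positivity
  -- the points
  have hmem : ∀ t ∈ S, |t| ≤ 2 * T := by
    intro t ht
    have h := hS.mem_bounds ht
    rw [abs_of_pos (by linarith [h.1])]
    exact h.2
  have hsep : ∀ t ∈ S, ∀ u ∈ S, t ≠ u → (1 : ℝ) ≤ |t - u| := fun t ht u hu h => hS.2 t ht u hu h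
  have hfar : ∀ t ∈ S, 1 < |t' t - t| := fun t ht => (hcomp t ht).1
  -- the maximisers
  set Lf : ℝ → ℂ := fun v => classGroupLFunction K ψ (1 / 2 + v * I) with hLf
  choose u hu1 hu2 humax using fun k : ℤ => exists_norm_max_unit K ψ k
  set F : ℝ → ℝ := fun v => ‖Lf v‖ ^ 2 with hF
  have hF0 : ∀ v, 0 ≤ F v := fun v => by positivity
  have hFmax : ∀ (k : ℤ) (v : ℝ), (k : ℝ) ≤ v → v ≤ k + 1 → F v ≤ F (u k) :=
    fun k v hv1 hv2 => pow_le_pow_left₀ (norm_nonneg _) (humax k v hv1 hv2) 2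
  set 𝒦 : Finset ℤ := S.image (fun t => ⌊t' t⌋) with h𝒦
  have hG : ∑ t ∈ S, F (t' t) / (t' t - t) ^ 2 ≤ 13 * Real.pi * ∑ k ∈ 𝒦, F (u k) :=
    far_sum_le_sup_sum (by positivity) (Finset.Subset.refl S) hmem hsep t' hfar F hF0 u hFmax
  have hrange : ∀ k ∈ 𝒦, T / 2 < u k ∧ u k ≤ 4 * T := by
    intro k hk
    obtain ⟨t, ht, htk⟩ := Finset.mem_image.mp hk
    have htS := hS.mem_bounds ht
    have hc := abs_le.1 (hcomp t ht).2
    have h1 : (k : ℝ) ≤ t' t := by rw [← htk]; exact Int.floor_le _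
    have h2' : t' t < k + 1 := by rw [← htk]; exact Int.lt_floor_add_one _
    have hk1 := hu1 k
    have hk2 := hu2 k
    constructor
    · linarith [htS.1, hc.1]
    · linarith [htS.2, hc.2]
  -- the windows at `T/2`, `T`, `2T`
  have hW₁ : ∀ U : Finset ℝ, IsDyadicPointSet U (T / 2) → ∑ x ∈ U, F x ≤ CL * X := by
    intro U hU
    have h := hL q hq hodd χ hprim hquad hoddχ K h2 hdisc ψ (T / 2) U hT66h hexph hU
    refine h.trans (mul_le_mul_of_nonneg_left ?_ hCL.le)
    have hc1 : calL χ (T / 2) ≤ cLT := calL_mono χ (by positivity) (by linarith)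
    have hc0 : 0 ≤ calL χ (T / 2) := calL_nonneg χ (by linarith)
    have hl0 : 0 ≤ Real.log (T / 2) := Real.log_nonneg (by linarith)
    have hl1 : Real.log (T / 2) ≤ LT := Real.log_le_log (by positivity) (by linarith)
    have hl4 : Real.log (T / 2) ^ (4 : ℕ) ≤ LT ^ (4 : ℕ) := pow_le_pow_left₀ hl0 hl1 4
    have hl40 : 0 ≤ Real.log (T / 2) ^ (4 : ℕ) := by positivity
    have hℓ7 : 0 ≤ ℓ ^ (7 : ℕ) := by positivity
    rw [hX]
    apply add_le_add
    · have : 0 ≤ T / 2 * ℓ ^ (7 : ℕ) := by positivity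
      linarith
    · have hh : T / 2 * calL χ (T / 2) * Real.log (T / 2) ^ (4 : ℕ) ≤ T * cLT * LT ^ (4 : ℕ) := by
        gcongr
        linarith
      exact hh
  have hW₂ : ∀ U : Finset ℝ, IsDyadicPointSet U T → ∑ x ∈ U, F x ≤ CL * X := by
    intro U hU
    exact hL q hq hodd χ hprim hquad hoddχ K h2 hdisc ψ T U hT66 hexp1 hU
  have hW₃ : ∀ U : Finset ℝ, IsDyadicPointSet U (2 * T) → ∑ x ∈ U, F x ≤ 64 * (CL * X) := by
    intro U hU
    have h := hL q hq hodd χ hprim hquad hoddχ K h2 hdisc ψ (2 * T) U hT66d hexpd hU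
    refine h.trans ?_
    have hc1 : calL χ (2 * T) ≤ 2 * cLT := calL_two_mul_le χ hT2
    have hc0 : 0 ≤ calL χ (2 * T) := calL_nonneg χ (by linarith)
    have hl2 : Real.log 2 ≤ LT := Real.log_le_log (by norm_num) hT2
    have hlog2T : Real.log (2 * T) = Real.log 2 + LT := by
      rw [hLT, Real.log_mul (by norm_num) hT0.ne']
    have hl1 : Real.log (2 * T) ≤ 2 * LT := by rw [hlog2T]; linarith
    have hl0 : 0 ≤ Real.log (2 * T) := Real.log_nonneg (by linarith)
    have hl4 : Real.log (2 * T) ^ (4 : ℕ) ≤ (2 * LT) ^ (4 : ℕ) := pow_le_pow_left₀ hl0 hl1 4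
    have hl40 : 0 ≤ Real.log (2 * T) ^ (4 : ℕ) := by positivity
    have hℓ7 : 0 ≤ ℓ ^ (7 : ℕ) := by positivity
    have hLT0 : 0 ≤ LT := by linarith
    have : 2 * T * ℓ ^ (7 : ℕ) + 2 * T * calL χ (2 * T) * Real.log (2 * T) ^ (4 : ℕ) ≤ 64 * X := by
      rw [hX]
      have e : (2 * LT) ^ (4 : ℕ) = 16 * LT ^ (4 : ℕ) := by ring
      rw [e] at hl4
      have h1 : 2 * T * calL χ (2 * T) * Real.log (2 * T) ^ (4 : ℕ) ≤
          2 * T * (2 * cLT) * (16 * LT ^ (4 : ℕ)) := by gcongr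
      have h0 : 0 ≤ T * ℓ ^ (7 : ℕ) := by positivity
      have e1 : 2 * T * (2 * cLT) * (16 * LT ^ (4 : ℕ)) = 64 * (T * cLT * LT ^ (4 : ℕ)) := by ring
      rw [e1] at h1
      linarith
    calc CL * (2 * T * ℓ ^ (7 : ℕ) + 2 * T * calL χ (2 * T) * Real.log (2 * T) ^ (4 : ℕ))
        ≤ CL * (64 * X) := mul_le_mul_of_nonneg_left this hCL.le
      _ = 64 * (CL * X) := by ring
  have hsup : ∑ k ∈ 𝒦, F (u k) ≤ 2 * (CL * X + CL * X + 64 * (CL * X)) :=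
    sum_sup_le F u (fun k => ⟨hu1 k, hu2 k⟩) 𝒦 hrange hW₁ hW₂ hW₃
  show ∑ t ∈ S, F (t' t) / (t' t - t) ^ 2 ≤ 13 * Real.pi * (132 * CL) * X
  refine hG.trans ?_
  have : 13 * Real.pi * ∑ k ∈ 𝒦, F (u k) ≤ 13 * Real.pi * (2 * (CL * X + CL * X + 64 * (CL * X))) :=
    mul_le_mul_of_nonneg_left hsup (by positivity)
  refine this.trans (le_of_eq ?_)
  ring

/-! ### §3. Proposition 8.1 for arbitrary companions, from Proposition 6.4 -/

/-- **CI PROPOSITION 8.1 (8.10) FOR ARBITRARY COMPANIONS, FROM PROPOSITION 6.4, IN THE RANGE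
`2q^66 ≤ T`, `2e^{(log q)²} ≤ T`.** For `q` odd `> 4`, `K = ℚ(√−q)`, `ψ ∈ Ĉℓ(K)`, a `1`-spaced
`S ⊂ (T, 2T]` and ANY companion map `t′ : ℝ → ℝ` (the printed (8.4): "to each point `s_r` we
associate a point `s′_r = ½ + it′_r`"):
`D(T) = Σ_{t∈S}|ℓ(s) − x(s)N̄(s)|² ≤ C·(T(log q)^7 + Tℒ(T)(log T)^4)` — the conclusion VERBATIM
(8.10). Close companions (`|t′ − t| ≤ 1`): the tree's
`conreyIwaniec2002_proposition81_large_close_of_proposition64`; far companions: `far_pointwise_D`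
with `Σ|L(s)|²` (`sum_norm_classGroupLFunction_sq_le`), `Σ|N(s)|²` (`sum_norm_shortLSum_sq_le`),
the far-companion sum (`far_companion_sq_sum_le`, `|t′ − t| ≤ T/4`) and the convexity bound
`|L(s′)|²/|t′ − t|² ≤ C` (`norm_sq_le_sq_dist_of_remote`, `|t′ − t| > T/4`). This removes the
companion restriction of the cell's Proposition 8.1 (no subconvexity is needed).
[cite: ConreyIwaniec2002, Proposition 8.1 (8.10)] -/
theorem prop81_unrestricted_of_proposition64 (h64 : conreyIwaniec2002_proposition64) :
    ∃ C : ℝ, 0 < C ∧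
    ∀ (q : ℕ) [NeZero q], 4 < q → Odd q → ∀ χ : DirichletCharacter ℂ q,
      χ.IsPrimitive → χ.IsQuadratic → χ.Odd →
        ∀ (K : Type) [Field K] [NumberField K],
          Module.finrank ℚ K = 2 → NumberField.discr K = -(q : ℤ) →
            ∀ (ψ : ClassGroup (𝓞 K) →* ℂˣ) (T : ℝ) (S : Finset ℝ) (t' : ℝ → ℝ),
              2 * (q : ℝ) ^ (66 : ℕ) ≤ T → 2 * Real.exp (Real.log q ^ (2 : ℕ)) ≤ T →
                IsDyadicPointSet S T →
                defectD K ψ q S t' ≤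
                  C * (T * Real.log q ^ (7 : ℕ) + T * calL χ T * Real.log T ^ (4 : ℕ)) := by
  obtain ⟨Ccl, hCcl, hclose⟩ := conreyIwaniec2002_proposition81_large_close_of_proposition64 h64
  obtain ⟨CL, hCL, hL⟩ := sum_norm_classGroupLFunction_sq_le h64
  obtain ⟨CN, hCN, hN⟩ := sum_norm_shortLSum_sq_le
  obtain ⟨CF, hCF, hFar⟩ := far_companion_sq_sum_le h64
  obtain ⟨Kc, hKc, hrem⟩ := norm_sq_le_sq_dist_of_remote
  refine ⟨Ccl + 3 * CL + 3 * CF + 6 * Kc + 12 * CN, by positivity,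
    fun q _ hq hodd χ hprim hquad hoddχ K _ _ h2 hdisc ψ T S t' hT hexpT hS => ?_⟩
  classical
  -- numerics
  have hq0 : 0 < q := by omega
  have hq5 : (5 : ℝ) ≤ q := by exact_mod_cast hq
  have hpow0 : 0 ≤ (q : ℝ) ^ (66 : ℕ) := by positivity
  have hexp0 := Real.exp_pos (Real.log q ^ (2 : ℕ))
  have hq66 : (q : ℝ) ^ (66 : ℕ) ≤ T := by linarith
  have hexp1 : Real.exp (Real.log q ^ (2 : ℕ)) ≤ T := by linarith
  obtain ⟨hℓ1, hℓLT, hLT1, -, hq41, -, hT3, -⟩ := prop81_numerics hq hq66 hexp1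
  have hT0 : 0 < T := by linarith
  have h625 : (5 : ℝ) ^ (4 : ℕ) ≤ (q : ℝ) ^ (4 : ℕ) := pow_le_pow_left₀ (by norm_num) hq5 4
  have hq4cast : ((q ^ 4 : ℕ) : ℝ) = (q : ℝ) ^ (4 : ℕ) := by push_cast; ring
  have hT4 : (626 : ℝ) ≤ T := by norm_num at h625; linarith
  have hq4T : (q : ℝ) ^ (4 : ℕ) ≤ T := by linarith
  have hT2 : (2 : ℝ) ≤ T := by linarith
  set ℓ : ℝ := Real.log q with hℓ
  set LT : ℝ := Real.log T with hLT
  set cLT : ℝ := calL χ T with hcLT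
  have hℓ0 : 0 ≤ ℓ := by linarith
  have hcLT0 : 0 ≤ cLT := calL_nonneg χ (by linarith)
  set X : ℝ := T * ℓ ^ (7 : ℕ) + T * cLT * LT ^ (4 : ℕ) with hX
  have hX0 : 0 ≤ X := by positivity
  have hTℓ5X : T * ℓ ^ (5 : ℕ) ≤ X := by
    have h57 : ℓ ^ (5 : ℕ) ≤ ℓ ^ (7 : ℕ) := pow_le_pow_right₀ hℓ1 (by norm_num)
    have h1 : T * ℓ ^ (5 : ℕ) ≤ T * ℓ ^ (7 : ℕ) := mul_le_mul_of_nonneg_left h57 hT0.le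
    have : 0 ≤ T * cLT * LT ^ (4 : ℕ) := by positivity
    rw [hX]; linarith
  have hTX : T ≤ X := by
    have h5 : (1 : ℝ) ≤ ℓ ^ (5 : ℕ) := one_le_pow₀ hℓ1
    have h8 : T ≤ T * ℓ ^ (5 : ℕ) := le_mul_of_one_le_right hT0.le h5
    linarith
  have hcard : (S.card : ℝ) ≤ 2 * T := (hS.isPointSet hT2).card_le' (by linarith)
  -- split `S` into close and far companions
  set Sc := S.filter (fun t => |t' t - t| ≤ 1) with hSc
  set Sf := S.filter (fun t => ¬ |t' t - t| ≤ 1) with hSf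
  have hsplit : defectD K ψ q S t' = defectD K ψ q Sc t' + defectD K ψ q Sf t' := by
    unfold defectD
    exact (Finset.sum_filter_add_sum_filter_not S _ _).symm
  have hScS : Sc ⊆ S := Finset.filter_subset _ _
  have hSfS : Sf ⊆ S := Finset.filter_subset _ _
  have hfar : ∀ t ∈ Sf, 1 < |t' t - t| := fun t ht => not_le.mp (Finset.mem_filter.1 ht).2
  -- (1) close companions: the tree's Proposition 8.1
  have hDc : defectD K ψ q Sc t' ≤ Ccl * X :=
    hclose q hq hodd χ hprim hquad hoddχ K h2 hdisc ψ T Sc t' hq66 hexp1 (hS.subset hScS)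
      (fun t ht => (Finset.mem_filter.1 ht).2)
  -- (2) far companions, pointwise
  set Lf : ℝ → ℂ := fun v => classGroupLFunction K ψ (1 / 2 + v * I) with hLf
  set Nf : ℝ → ℂ := fun v => shortLSum K ψ q (1 / 2 + v * I) with hNf
  have hDf : defectD K ψ q Sf t' ≤
      ∑ t ∈ Sf, (3 * ‖Lf t‖ ^ 2 + 3 * (‖Lf (t' t)‖ ^ 2 / (t' t - t) ^ 2) + 12 * ‖Nf t‖ ^ 2) := by
    unfold defectD
    exact Finset.sum_le_sum fun t ht => far_pointwise_D K ψ hq0 (hfar t ht)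
  have hsum : ∑ t ∈ Sf, (3 * ‖Lf t‖ ^ 2 + 3 * (‖Lf (t' t)‖ ^ 2 / (t' t - t) ^ 2) + 12 * ‖Nf t‖ ^ 2) =
      3 * ∑ t ∈ Sf, ‖Lf t‖ ^ 2 + 3 * ∑ t ∈ Sf, ‖Lf (t' t)‖ ^ 2 / (t' t - t) ^ 2 +
        12 * ∑ t ∈ Sf, ‖Nf t‖ ^ 2 := by
    rw [Finset.sum_add_distrib, Finset.sum_add_distrib, Finset.mul_sum, Finset.mul_sum,
      Finset.mul_sum]
  rw [hsum] at hDf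
  -- (2a) the two mean squares at hand
  have hA : ∑ t ∈ Sf, ‖Lf t‖ ^ 2 ≤ CL * X :=
    (Finset.sum_le_sum_of_subset_of_nonneg hSfS fun _ _ _ => by positivity).trans
      (hL q hq hodd χ hprim hquad hoddχ K h2 hdisc ψ T S hq66 hexp1 hS)
  have hC : ∑ t ∈ Sf, ‖Nf t‖ ^ 2 ≤ CN * X := by
    calc ∑ t ∈ Sf, ‖Nf t‖ ^ 2 ≤ ∑ t ∈ S, ‖Nf t‖ ^ 2 :=
          Finset.sum_le_sum_of_subset_of_nonneg hSfS fun _ _ _ => by positivity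
      _ ≤ CN * (T * ℓ ^ (5 : ℕ)) := hN q hq hodd χ hprim hquad hoddχ K h2 hdisc ψ T S hq4T hS
      _ ≤ CN * X := mul_le_mul_of_nonneg_left hTℓ5X hCN.le
  -- (2b) the companion terms: within `T/4` by the far-companion sum, beyond by convexity
  set Sfar := Sf.filter (fun t => |t' t - t| ≤ T / 4) with hSfar
  set Srem := Sf.filter (fun t => ¬ |t' t - t| ≤ T / 4) with hSrem
  have hSfarS : Sfar ⊆ S := (Finset.filter_subset _ _).trans hSfS
  have hSremS : Srem ⊆ S := (Finset.filter_subset _ _).trans hSfS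
  have hBsplit : ∑ t ∈ Sf, ‖Lf (t' t)‖ ^ 2 / (t' t - t) ^ 2 =
      ∑ t ∈ Sfar, ‖Lf (t' t)‖ ^ 2 / (t' t - t) ^ 2 + ∑ t ∈ Srem, ‖Lf (t' t)‖ ^ 2 / (t' t - t) ^ 2 :=
    (Finset.sum_filter_add_sum_filter_not Sf _ _).symm
  have hBfar : ∑ t ∈ Sfar, ‖Lf (t' t)‖ ^ 2 / (t' t - t) ^ 2 ≤ CF * X :=
    hFar q hq hodd χ hprim hquad hoddχ K h2 hdisc ψ T Sfar t' hT hexpT (hS.subset hSfarS)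
      (fun t ht => ⟨hfar t (Finset.filter_subset _ _ ht), (Finset.mem_filter.1 ht).2⟩)
  have hBrem : ∑ t ∈ Srem, ‖Lf (t' t)‖ ^ 2 / (t' t - t) ^ 2 ≤ 2 * Kc * X := by
    have hpt : ∀ t ∈ Srem, ‖Lf (t' t)‖ ^ 2 / (t' t - t) ^ 2 ≤ Kc := by
      intro t ht
      have hd : T / 4 < |t' t - t| := not_le.mp (Finset.mem_filter.1 ht).2
      have htS := hS.mem_bounds (hSremS ht)
      have h := hrem q hq χ hprim hquad hoddχ K h2 hdisc ψ T t (t' t) hq4T htS.1 htS.2 hd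
      have hd0 : 0 < |t' t - t| := by linarith
      have hd2 : 0 < (t' t - t) ^ 2 := by rw [← sq_abs]; positivity
      rw [div_le_iff₀ hd2]
      exact h
    have hcardr : (Srem.card : ℝ) ≤ 2 * T := by
      have : (Srem.card : ℝ) ≤ S.card := by exact_mod_cast Finset.card_le_card hSremS
      linarith
    calc ∑ t ∈ Srem, ‖Lf (t' t)‖ ^ 2 / (t' t - t) ^ 2 ≤ ∑ t ∈ Srem, Kc := Finset.sum_le_sum hpt
      _ = Srem.card * Kc := by rw [Finset.sum_const, nsmul_eq_mul]
      _ ≤ 2 * T * Kc := mul_le_mul_of_nonneg_right hcardr hKc.le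
      _ = 2 * Kc * T := by ring
      _ ≤ 2 * Kc * X := mul_le_mul_of_nonneg_left hTX (by positivity)
  have hB : ∑ t ∈ Sf, ‖Lf (t' t)‖ ^ 2 / (t' t - t) ^ 2 ≤ CF * X + 2 * Kc * X := by
    rw [hBsplit]; exact add_le_add hBfar hBrem
  -- assemble
  have hDfX : defectD K ψ q Sf t' ≤ (3 * CL + 3 * CF + 6 * Kc + 12 * CN) * X := by
    have hexpand : (3 * CL + 3 * CF + 6 * Kc + 12 * CN) * X =
        3 * (CL * X) + 3 * (CF * X + 2 * Kc * X) + 12 * (CN * X) := by ring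
    rw [hexpand]
    linarith [hDf, hA, hB, hC]
  have hcomb : (Ccl + 3 * CL + 3 * CF + 6 * Kc + 12 * CN) * X =
      Ccl * X + (3 * CL + 3 * CF + 6 * Kc + 12 * CN) * X := by ring
  rw [hsplit, hcomb]
  exact add_le_add hDc hDfX

end ConreyIwaniec2002

end Literature.NumberTheory.LFunctions

end
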